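import Mathlib
import Literature.MathematicalPhysics.QuantumLattice.SchwartzTensor
import Literature.MathematicalPhysics.AQFT.OSAxiomsSchwinger
import HarnessLib

/-!
# `ContinuumLegGivenGap` (stmt-QuantumFields-15828), line `Sketch` (reshape 7): the witness bridge

Support file for the crux item stmt-QuantumFields-15828 (registered stub `stub_witness` of the
line `Sketch`, reshape 7: UV-discharge dock on the compactness socket stmt-15926
`FlowLineStateSpace.OSLimitFromUniformBounds`).

**Statement** (`stub_witness`, the card's `FirstLemma` in lattice form, over an ABSTRACT sequence
of three-point functionals `LS : ℕ → 𝓢((Fin 3 → ℝ⁴), ℂ) → ℂ`). Suppose there is an NLO window: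
a non-zero coefficient `s₃`, sequences of one-point test functions `f j, g j, h j`, off-diagonal
tensors `F₃ j = f j ⊗ g j ⊗ h j` and weights `w j > 0` such that for every `ε > 0`, eventually in
`j`, eventually in `k`, `‖LS k (F₃ j) / w j - s₃‖ ≤ ε`. Then there are ONE off-diagonal tensor
`F₃ = f ⊗ g ⊗ h` and `δ > 0` with `δ ≤ ‖LS k F₃‖` frequently in `k` — the (NG) hypothesis of the
socket.

**Proof.** Pure filter logic. Take `ε := ‖s₃‖ / 2 > 0`. Since `atTop` on `ℕ` is non-trivial, the
window yields one index `j` with `‖LS k (F₃ j) / w j - s₃‖ ≤ ‖s₃‖ / 2` eventually in `k`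
(`Filter.Eventually.exists`). For such `k` the reverse triangle inequality gives
`‖LS k (F₃ j)‖ / w j ≥ ‖s₃‖ - ‖s₃‖ / 2 = ‖s₃‖ / 2`, i.e. `‖LS k (F₃ j)‖ ≥ δ := w j · ‖s₃‖ / 2 > 0`;
an eventual property is frequent (`Filter.Eventually.frequently`). The witnesses are
`f j, g j, h j, F₃ j`. [folklore]
-/

noncomputable section

namespace Summit.QuantumFields.YangMills.Theorems.ContinuumLegGivenGap

open Filter Topology
open Literature.MathematicalPhysics.QuantumLattice Literature.MathematicalPhysics.AQFT

/-- `stub_witness` — **the card's `FirstLemma` in lattice form** (pure filter logic over an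
ABSTRACT sequence of three-point functionals): a window converging to `s₃ ≠ 0` yields ONE
off-diagonal tensor and `δ > 0` with `δ ≤ ‖LS_k(F₃)‖` frequently (indeed eventually) in `k` — the
(NG) hypothesis of stmt-15926. [folklore] -/
theorem stub_witness :
    ∀ (LS : ℕ → SchwartzMap (Fin 3 → EuclideanSpace ℝ (Fin 4)) ℂ → ℂ),
      (∃ (s₃ : ℂ) (f g h : ℕ → SchwartzMap (EuclideanSpace ℝ (Fin 4)) ℂ)
        (F₃ : ℕ → SchwartzMap (Fin 3 → EuclideanSpace ℝ (Fin 4)) ℂ) (w : ℕ → ℝ),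
        s₃ ≠ 0 ∧ (∀ j, 0 < w j) ∧ (∀ j, IsTensorOf (F₃ j) ![f j, g j, h j] ∧ IsOffDiagonal (F₃ j)) ∧
          ∀ ε : ℝ, 0 < ε → ∀ᶠ j in atTop, ∀ᶠ k in atTop, ‖LS k (F₃ j) / (w j : ℂ) - s₃‖ ≤ ε) →
      ∃ (f g h : SchwartzMap (EuclideanSpace ℝ (Fin 4)) ℂ) (F₃ : SchwartzMap (Fin 3 → EuclideanSpace ℝ (Fin 4)) ℂ),
        IsTensorOf F₃ ![f, g, h] ∧ IsOffDiagonal F₃ ∧ ∃ δ : ℝ, 0 < δ ∧ ∃ᶠ k in atTop, δ ≤ ‖LS k F₃‖ := by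
  rintro LS ⟨s₃, f, g, h, F₃, w, hs₃, hw, hF, hwin⟩
  have hε : 0 < ‖s₃‖ / 2 := half_pos (norm_pos_iff.mpr hs₃)
  obtain ⟨j, hj⟩ := (hwin (‖s₃‖ / 2) hε).exists
  refine ⟨f j, g j, h j, F₃ j, (hF j).1, (hF j).2, w j * (‖s₃‖ / 2), mul_pos (hw j) hε, ?_⟩
  refine Filter.Eventually.frequently (hj.mono fun k hk => ?_)
  have hwj : 0 < w j := hw j
  have h1 : ‖s₃‖ - ‖LS k (F₃ j) / (w j : ℂ)‖ ≤ ‖s₃‖ / 2 :=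
    calc ‖s₃‖ - ‖LS k (F₃ j) / (w j : ℂ)‖ ≤ ‖s₃ - LS k (F₃ j) / (w j : ℂ)‖ := norm_sub_norm_le _ _
      _ = ‖LS k (F₃ j) / (w j : ℂ) - s₃‖ := norm_sub_rev _ _
      _ ≤ ‖s₃‖ / 2 := hk
  have h2 : ‖LS k (F₃ j) / (w j : ℂ)‖ = ‖LS k (F₃ j)‖ / w j := by
    rw [norm_div, Complex.norm_real, Real.norm_eq_abs, abs_of_pos hwj]
  rw [h2] at h1
  have h3 : ‖s₃‖ / 2 ≤ ‖LS k (F₃ j)‖ / w j := by linarith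
  rw [le_div_iff₀ hwj] at h3
  linarith

end Summit.QuantumFields.YangMills.Theorems.ContinuumLegGivenGap

end
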